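import Mathlib.Analysis.InnerProductSpace.PiL2
import Mathlib.LinearAlgebra.FiniteDimensional.Lemmas
import Literature.Geometry.DiscreteGeometry.TwoShellPatterns
import Literature.MathematicalPhysics.StatisticalMechanics.BarlowStacking
import HarnessLib

/-!
# The `√18` integer model of the two-shell patterns and of the ideal Barlow template

Topic `Literature/Geometry/DiscreteGeometry`; companion of `KissingPatterns.lean` / `TwoShellPatterns.lean`
(conventions: contact distance `1`, integer models scaled by `1/√N`).  Requested by the chart step of route
`Summits/AtomisticToContinuum/Crystallization/Theses/PhononSlackCertificates` (crux `NearFieldConvexity`,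
stub `stub_chartCore`), where every finite-geometry decision (label identification, candidate placements of a
witnessed pattern, compatibility of neighbouring placements, template-site enumeration) is an integer computation
decided by `decide`, and only the final placement is real analysis.

**Content.**
* `det3Int`, `cramerInt`, `cramerInt_spec` — Cramer's rule on `ℤ³`: for columns `a b c` and a vector `w`,
  `λ₁ a + λ₂ b + λ₃ c = (det3Int a b c) • w` with `λ = cramerInt a b c w`.  [folklore]
* `fccModelInt`, `hcpModelInt` — the two-shell patterns as subsets of `ℤ³` at the COMMON scale `1/√18`
  (`hcpTwoShellPattern` is already defined at that scale; the fcc integer vectors are multiplied by `3`):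
  `fccTwoShellPattern = fccModelInt.image (v ↦ v/√18)` (`fccTwoShellPattern_eq_image`), and `rfl` for hcp.
* `barlowSiteInt m u v L = (3u + L + 2m, −3u − 3v − 2L + 2m, 3v + L + 2m)` and the **cuboctahedral frame**
  `cuboFrame : ℝ³ →ₗᵢ ℝ³` with `cuboFrame (barlowPos 1 (√6/3) s m u v) = (barlowSiteInt m u v (haggLabel s m))/√18`
  (`cuboFrame_barlowPos`): the layer frame of the ideal Barlow template (unit in-plane spacing, layer height
  `√(2/3) = √6/3`) is carried onto `(1,−1,0)/√2, (−1,−1,2)/√6, (1,1,1)/√3`, so that template sites, pattern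
  points and the candidate placements of the chart all live in `ℤ³/√18`, where squared distances are
  `sqNormInt (v − w)/18` (`dist_sq_intVec_div`).  In these coordinates the fcc stacking (`constHagg`) is the lattice
  `D₃·3/√18 = D₃/√2` (Conway–Sloane, *SPLAG* Ch. 4 §6.3) and the alternating word gives `hcpTwoShellPattern` around
  the origin (Hales, *Dense Sphere Packings* §1.3).
Nothing here is specific to Lennard-Jones; no named fact is introduced.

## Mathlib / tree search
Tree: `intVec`, `sqNormInt`, `scaledPattern`, `fccInt`, `hcpInt` (`KissingPatterns`), `fccSecondShellInt`,
`hcpSecondShellInt`, `fccTwoShellPattern`, `hcpTwoShellPattern` (`TwoShellPatterns`), `barlowPos`, `haggLabel`,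
`barlowPos_apply_zero/one/two` (`BarlowStacking`); no integer model of the Barlow template, no frame isometry
(`lean search 'cubo|D3|integer model'`); `LayerShellPatterns.closePackingFrame σ` is the INVERSE direction (cuboctahedron
coordinates → layer coordinates) at Hales's scale `2` for the first shell — the present file needs the forward frame at
contact distance `1` with the two-shell `√18` model and the integer site formula, so it is stated afresh (the two frames
agree up to the half-turn recorded by `σ`).  Mathlib: `Matrix.det`/`Matrix.cramer` exist for general matrices; the
explicit `Fin 3` versions below are chosen so that `decide` evaluates them by integer arithmetic;
`OrthonormalBasis.mk`, `OrthonormalBasis.sum_repr_symm`, `EuclideanSpace.inner_eq_star_dotProduct`.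

## References
* J. H. Conway, N. J. A. Sloane, *Sphere Packings, Lattices and Groups*, 3rd ed. (1999), Ch. 4 §6.3. [ConwaySloane1999]
* T. C. Hales, *Dense Sphere Packings* (2012), §1.3. [HalesDSP2012]
-/

noncomputable section

namespace Literature.Geometry.DiscreteGeometry

open Literature.MathematicalPhysics.StatisticalMechanics

/-! ### Cramer's rule on `ℤ³` (computable, for `decide`) -/

/-- The determinant of the `3 × 3` integer matrix with COLUMNS `a, b, c`. [folklore] -/
def det3Int (a b c : Fin 3 → ℤ) : ℤ :=
  a 0 * (b 1 * c 2 - b 2 * c 1) - b 0 * (a 1 * c 2 - a 2 * c 1) + c 0 * (a 1 * b 2 - a 2 * b 1)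

/-- Cramer coefficients: `cramerInt a b c w = (det[w b c], det[a w c], det[a b w])`. [folklore] -/
def cramerInt (a b c w : Fin 3 → ℤ) : Fin 3 → ℤ :=
  ![det3Int w b c, det3Int a w c, det3Int a b w]

/-- **Cramer's rule**: `λ₀ a + λ₁ b + λ₂ c = (det3Int a b c) • w` for `λ = cramerInt a b c w`
(an identity of integer polynomials, valid also when the determinant vanishes). [folklore] -/
theorem cramerInt_spec (a b c w : Fin 3 → ℤ) :
    cramerInt a b c w 0 • a + cramerInt a b c w 1 • b + cramerInt a b c w 2 • c = det3Int a b c • w := by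
  ext i
  fin_cases i <;> simp [cramerInt, det3Int] <;> ring

/-- The squared norm of an integer vector, expanded (for rewriting real computations). [folklore] -/
theorem sqNormInt_eq (v : Fin 3 → ℤ) : sqNormInt v = v 0 * v 0 + v 1 * v 1 + v 2 * v 2 := by
  simp [sqNormInt, sq]

/-! ### The patterns at the common scale `1/√18` -/

/-- The fcc two-shell pattern as integer vectors at scale `1/√18`: `3 · (fccInt ∪ fccSecondShellInt)`
(twelve vectors `(±3,±3,0)`-type and six `(±6,0,0)`-type). [cite: ConwaySloane1999, Ch. 4 §6.3] -/
def fccModelInt : Finset (Fin 3 → ℤ) :=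
  (fccInt ∪ fccSecondShellInt).image fun v => 3 • v

/-- The hcp two-shell pattern as integer vectors at scale `1/√18` (this is the scale of `hcpTwoShellPattern`).
[cite: HalesDSP2012, §1.3] -/
def hcpModelInt : Finset (Fin 3 → ℤ) :=
  hcpInt ∪ hcpSecondShellInt

/-- `√18 = 3 √2` (a private copy of `LayerShellPatterns.sqrt_eighteen_eq`, to keep the imports light). [folklore] -/
private theorem sqrt18_eq : Real.sqrt 18 = 3 * Real.sqrt 2 := by
  rw [show (18 : ℝ) = 3 ^ 2 * 2 by norm_num, Real.sqrt_mul (by norm_num), Real.sqrt_sq (by norm_num)]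

/-- Rescaling an integer model: `v/√2 = (3v)/√18`. [folklore] -/
theorem inv_sqrt_two_smul_intVec (v : Fin 3 → ℤ) :
    (Real.sqrt 2)⁻¹ • intVec v = (Real.sqrt 18)⁻¹ • intVec (3 • v) := by
  have h3 : intVec (3 • v) = (3 : ℝ) • intVec v := by
    ext i; simp [intVec]
  rw [h3, sqrt18_eq, smul_smul, mul_inv]
  congr 1
  field_simp

/-- `fccTwoShellPattern` is the image of `fccModelInt` under `v ↦ v/√18`. [cite: ConwaySloane1999, Ch. 4 §6.3] -/
theorem fccTwoShellPattern_eq_image :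
    fccTwoShellPattern = fccModelInt.image fun v => (Real.sqrt (18 : ℕ))⁻¹ • intVec v := by
  rw [fccTwoShellPattern, scaledPattern, fccModelInt, Finset.image_image]
  refine Finset.image_congr fun v _ => ?_
  simp only [Function.comp_apply, Nat.cast_ofNat]
  exact inv_sqrt_two_smul_intVec v

/-- `hcpTwoShellPattern` is the image of `hcpModelInt` under `v ↦ v/√18` (by definition). [cite: HalesDSP2012, §1.3] -/
theorem hcpTwoShellPattern_eq_image :
    hcpTwoShellPattern = hcpModelInt.image fun v => (Real.sqrt (18 : ℕ))⁻¹ • intVec v := rfl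

/-- Both integer models have eighteen vectors. [folklore] -/
theorem card_fccModelInt : fccModelInt.card = 18 := by decide

/-- Both integer models have eighteen vectors. [folklore] -/
theorem card_hcpModelInt : hcpModelInt.card = 18 := by decide

/-- **Squared distances in the `√18` model are integers over `18`.** [folklore] -/
theorem dist_sq_intVec_div (v w : Fin 3 → ℤ) :
    dist ((Real.sqrt 18)⁻¹ • intVec v) ((Real.sqrt 18)⁻¹ • intVec w) ^ 2 = (sqNormInt (v - w) : ℝ) / 18 := by
  have hpos : (0 : ℝ) < Real.sqrt 18 := Real.sqrt_pos.2 (by norm_num)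
  have hnn : (0 : ℝ) ≤ (sqNormInt (v - w) : ℝ) := by
    have : (0 : ℤ) ≤ sqNormInt (v - w) := by unfold sqNormInt; positivity
    exact_mod_cast this
  rw [dist_eq_norm, ← smul_sub, intVec_sub, norm_smul, norm_inv, Real.norm_of_nonneg hpos.le, norm_intVec,
    mul_pow, inv_pow, Real.sq_sqrt (by norm_num), Real.sq_sqrt hnn]
  ring

/-- The norm of a model point: `‖v/√18‖² = sqNormInt v / 18`. [folklore] -/
theorem norm_sq_intVec_div (v : Fin 3 → ℤ) :
    ‖(Real.sqrt 18)⁻¹ • intVec v‖ ^ 2 = (sqNormInt v : ℝ) / 18 := by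
  have h0 : (Real.sqrt 18)⁻¹ • intVec 0 = 0 := by
    have : intVec 0 = 0 := by ext i; simp [intVec]
    rw [this, smul_zero]
  have := dist_sq_intVec_div v 0
  rwa [h0, dist_zero_right, sub_zero] at this

/-! ### The ideal Barlow template in the cuboctahedral frame -/

/-- The site `(m, u, v)` with letter `L` of the ideal Barlow template, in the `√18` model of the cuboctahedral frame:
`3u·(1,−1,0) + 3v·(0,−1,1) + L·(1,−2,1) + 2m·(1,1,1)`. [folklore] -/
def barlowSiteInt (m u v L : ℤ) : Fin 3 → ℤ :=
  ![3 * u + L + 2 * m, -(3 * u) - 3 * v - 2 * L + 2 * m, 3 * v + L + 2 * m]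

/-- The cuboctahedral frame vectors `(1,−1,0)/√2`, `(−1,−1,2)/√6`, `(1,1,1)/√3` are orthonormal. [folklore] -/
theorem cuboFrameVec_orthonormal :
    Orthonormal ℝ (![!₂[Real.sqrt 2 / 2, -(Real.sqrt 2 / 2), 0], !₂[-(Real.sqrt 6 / 6), -(Real.sqrt 6 / 6), Real.sqrt 6 / 3],
        !₂[Real.sqrt 3 / 3, Real.sqrt 3 / 3, Real.sqrt 3 / 3]] : Fin 3 → EuclideanSpace ℝ (Fin 3)) := by
  have h2 : Real.sqrt 2 * Real.sqrt 2 = 2 := Real.mul_self_sqrt (by norm_num)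
  have h3 : Real.sqrt 3 * Real.sqrt 3 = 3 := Real.mul_self_sqrt (by norm_num)
  have h6 : Real.sqrt 6 * Real.sqrt 6 = 6 := Real.mul_self_sqrt (by norm_num)
  have h23 : Real.sqrt 2 * Real.sqrt 3 = Real.sqrt 6 := by rw [← Real.sqrt_mul (by norm_num)]; norm_num
  have h26 : Real.sqrt 2 * Real.sqrt 6 = 2 * Real.sqrt 3 := by rw [← h23, ← mul_assoc, h2]
  have h36 : Real.sqrt 3 * Real.sqrt 6 = 3 * Real.sqrt 2 := by rw [← h23, mul_comm (Real.sqrt 2), ← mul_assoc, h3]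
  rw [orthonormal_iff_ite]
  intro i j
  fin_cases i <;> fin_cases j <;>
    · simp only [Fin.zero_eta, Fin.mk_one, Fin.reduceFinMk, Fin.isValue, Matrix.cons_val_zero, Matrix.cons_val_one,
        Matrix.cons_val]
      rw [EuclideanSpace.inner_eq_star_dotProduct]
      simp [dotProduct, Fin.sum_univ_three]
      try nlinarith [h2, h3, h6, h23, h26, h36]

/-- The cuboctahedral frame vectors span `ℝ³`. [folklore] -/
theorem cuboFrameVec_span :
    ⊤ ≤ Submodule.span ℝ (Set.range (![!₂[Real.sqrt 2 / 2, -(Real.sqrt 2 / 2), 0],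
      !₂[-(Real.sqrt 6 / 6), -(Real.sqrt 6 / 6), Real.sqrt 6 / 3],
      !₂[Real.sqrt 3 / 3, Real.sqrt 3 / 3, Real.sqrt 3 / 3]] : Fin 3 → EuclideanSpace ℝ (Fin 3))) :=
  (cuboFrameVec_orthonormal.linearIndependent.span_eq_top_of_card_eq_finrank' (by simp)).ge

/-- **The cuboctahedral frame as an isometric equivalence** of `ℝ³`: the standard basis (the layer frame of
`barlowPos`) goes to `(1,−1,0)/√2, (−1,−1,2)/√6, (1,1,1)/√3`. [folklore] -/
def cuboFrameEquiv : EuclideanSpace ℝ (Fin 3) ≃ₗᵢ[ℝ] EuclideanSpace ℝ (Fin 3) :=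
  (OrthonormalBasis.mk cuboFrameVec_orthonormal cuboFrameVec_span).repr.symm

/-- **The cuboctahedral frame** `R₀ : ℝ³ →ₗᵢ ℝ³` (the linear isometry underlying `cuboFrameEquiv`). [folklore] -/
def cuboFrame : EuclideanSpace ℝ (Fin 3) →ₗᵢ[ℝ] EuclideanSpace ℝ (Fin 3) :=
  cuboFrameEquiv.toLinearIsometry

/-- `cuboFrame` is `cuboFrameEquiv` as a map. [folklore] -/
@[simp] theorem coe_cuboFrameEquiv : ⇑cuboFrameEquiv = ⇑cuboFrame := rfl

/-- `R₀ x = x₀ • (1,−1,0)/√2 + x₁ • (−1,−1,2)/√6 + x₂ • (1,1,1)/√3`. [folklore] -/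
theorem cuboFrame_apply (x : EuclideanSpace ℝ (Fin 3)) :
    cuboFrame x = ∑ i, x i • (![!₂[Real.sqrt 2 / 2, -(Real.sqrt 2 / 2), 0],
      !₂[-(Real.sqrt 6 / 6), -(Real.sqrt 6 / 6), Real.sqrt 6 / 3],
      !₂[Real.sqrt 3 / 3, Real.sqrt 3 / 3, Real.sqrt 3 / 3]] : Fin 3 → EuclideanSpace ℝ (Fin 3)) i := by
  rw [← OrthonormalBasis.coe_mk cuboFrameVec_orthonormal cuboFrameVec_span]
  exact (OrthonormalBasis.sum_repr_symm (OrthonormalBasis.mk cuboFrameVec_orthonormal cuboFrameVec_span) x).symm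

/-- **The template in the integer model**:
`R₀ (barlowPos 1 (√6/3) s m u v) = (3u + L + 2m, −3u − 3v − 2L + 2m, 3v + L + 2m)/√18`, `L = haggLabel s m`.
[folklore] -/
theorem cuboFrame_barlowPos (s : ℤ → ℤ) (m u v : ℤ) :
    cuboFrame (barlowPos 1 (Real.sqrt 6 / 3) s m u v) =
      (Real.sqrt 18)⁻¹ • intVec (barlowSiteInt m u v (haggLabel s m)) := by
  have h2 : Real.sqrt 2 * Real.sqrt 2 = 2 := Real.mul_self_sqrt (by norm_num)
  have h3 : Real.sqrt 3 * Real.sqrt 3 = 3 := Real.mul_self_sqrt (by norm_num)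
  have h23 : Real.sqrt 2 * Real.sqrt 3 = Real.sqrt 6 := by rw [← Real.sqrt_mul (by norm_num)]; norm_num
  have hs2 : (0 : ℝ) < Real.sqrt 2 := Real.sqrt_pos.2 (by norm_num)
  have hsq2 : Real.sqrt 2 ^ 2 = 2 := by rw [sq]; exact h2
  have hsq3 : Real.sqrt 3 ^ 2 = 3 := by rw [sq]; exact h3
  rw [cuboFrame_apply, sqrt18_eq]
  ext l
  fin_cases l <;>
    · simp [Fin.sum_univ_three, barlowPos_apply_zero, barlowPos_apply_one, barlowPos_apply_two, barlowSiteInt]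
      field_simp
      rw [← h23]
      ring_nf
      simp only [hsq2, hsq3]
      ring_nf

/-- The coordinate sum of a template site is `6m` (it determines the layer). [folklore] -/
theorem barlowSiteInt_sum (m u v L : ℤ) :
    barlowSiteInt m u v L 0 + barlowSiteInt m u v L 1 + barlowSiteInt m u v L 2 = 6 * m := by
  simp [barlowSiteInt]; ring

/-- The origin is the site `(0,0,0)` (letter `0`). [folklore] -/
@[simp] theorem barlowSiteInt_zero : barlowSiteInt 0 0 0 0 = 0 := by
  ext i; fin_cases i <;> simp [barlowSiteInt]

end Literature.Geometry.DiscreteGeometry
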